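import Summits.AtomisticToContinuum.HydrodynamicLimit.Theorems.StiffCollisionalRelaxationAprioriBoundsFibrePartOnePrimeA
import Summits.AtomisticToContinuum.HydrodynamicLimit.Theorems.StiffCollisionalRelaxationAprioriBoundsFibreDefsR4
import HarnessLib

/-!
# Component (i) of the a-priori crux from the rate-free, time-integrated tail packages (stub `stub_partOnePrime`)

Supporting file of the line `fibre-deficit-transfer` for the crux `AprioriBounds`
(stmt-AtomisticToContinuum-14827; `StiffCollisionalRelaxation.AprioriBounds` =
`CollisionIsometryCLT.AprioriBoundsPreShock`), lead prover `prover-line-stmt-AtomisticToContinuum-14827-a1-0`,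
skeleton r4 (RATE-FREE, TIME-INTEGRATED (i)-chain).  It proves the registered stub 6, `stub_partOnePrime`: for
`0 < σ ≤ 1/2`, nice profiles and `t > 0`,

  `IntegratedBulkTailAt σ a₀ θ₀ u₀ Φ t → FarTailAllAt σ a₀ θ₀ u₀ Φ t → PartOneAt σ a₀ θ₀ u₀ Φ t`,

i.e. the TIME-INTEGRATED sub-Maxwellian one-particle tails at every level (`Θ, A`: for every slack `δ > 0` and
`ε > 0`, eventually `∫₀ᵗ P_N{2A e^{−K/(2Θ)} + δ < frac_K(s)} ds ≤ ε` for all `K`) plus the far-tail occupation bound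
in the mean at all levels (`Θ', A'`: `E_N ∫₀ᵗ frac_K(s) ds ≤ tA'e^{−K/(2Θ')}`) give component (i) of the crux VERBATIM:
`∃ λ > 0, C` with `P_N{C < ∫₀ᵗ (N+1)⁻¹∑ᵢ e^{λ|vᵢ(s)|²} ds} → 0`.  No dynamics is used beyond the hard-sphere-flow
axioms and energy conservation; no rate is needed anywhere.

## Proof (layer cake + fixed level cut + Markov/Tonelli)

Dial `λ := 1/(4(Θ + Θ'))` (`pp_exists_dial`: `λ < 1/(2Θ)`, `λ < 1/(2Θ')`), put `δ₁ = 1/(2Θ) − λ`,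
`δ₂ = 1/(2Θ') − λ`, `ρ = e^{−δ₂} < 1`, `C_λ := 2A⁺e^{λ}/(1 − e^{−δ₁})` and the FIXED threshold `C := t·C_λ + 1`.
Given `η > 0`: choose a FIXED level cut `M` with `tA'⁺e^{λ}ρ^{M}/(1 − ρ) < η/4` (geometric decay in `M`), then the
slack `δ := 1/(2tS₁ + 2)` (`S₁ = ∑_{K<M}e^{λ(K+1)}`, so `tδS₁ ≤ 1/2`) and `ε := η/(4S₁ + 4)` in `IntegratedBulkTailAt`.
For `N` beyond both thresholds, `partOnePrime_bound_at` (the particle-number-wise bound: thresholds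
`thr_K = 2A⁺e^{−K/(2Θ)} + δ` on the levels `K < M`, deterministic part `≤ t·C_λ + 1/2`, time-integrated bad events
`∫₀ᵗ P(bad(K,s)) ds ≤ ε`, far levels `e^{λ(j+M+1)}E∫₀ᵗfrac_{j+M} ≤ tA'⁺e^{λ}ρ^{M}·ρ^j`, and the time-integrated
Markov–Tonelli step `partOnePrime_markov_step` of `…FibrePartOnePrimeA.lean`) gives
`P_N(bad) ≤ 2(εS₁ + tA'⁺e^{λ}ρ^M/(1 − ρ)) ≤ η`.  Hence `P_N(bad) → 0` (`ENNReal.tendsto_nhds_zero`).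

No new definitions, no named facts; axioms `propext`, `Classical.choice`, `Quot.sound`.
-/

noncomputable section

open MeasureTheory Filter Set Topology
open scoped ENNReal

namespace Summit.AtomisticToContinuum.HydrodynamicLimit.Theorems.FibreDeficitTransfer

open Literature.MathematicalPhysics.KineticTheory Literature.Analysis.FluidPDE
open Summit.AtomisticToContinuum.HydrodynamicLimit.Theorems.AprioriBoundsNegative (PartOneAt PartTwoAt)
open Summit.AtomisticToContinuum.HydrodynamicLimit.Theorems.VisitLedgerUpscattering (Cfg Flow Flows NiceProfiles)

/-! ## Real-analysis lemmas: the dial and the bulk geometric sum -/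

/-- **THE RATE-FREE DIAL.**  For `Θ, Θ' > 0` there is `λ > 0` with `λ < 1/(2Θ)` and `λ < 1/(2Θ')`
(take `λ := 1/(4(Θ + Θ'))`). -/
theorem pp_exists_dial {Θ Θ' : ℝ} (hΘ : 0 < Θ) (hΘ' : 0 < Θ') :
    ∃ lam : ℝ, 0 < lam ∧ 0 < 1 / (2 * Θ) - lam ∧ 0 < 1 / (2 * Θ') - lam := by
  refine ⟨1 / (4 * (Θ + Θ')), by positivity, ?_, ?_⟩
  · rw [sub_pos]
    exact one_div_lt_one_div_of_lt (by positivity) (by linarith)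
  · rw [sub_pos]
    exact one_div_lt_one_div_of_lt (by positivity) (by linarith)

-- adapted from the rated sibling …FibrePartOneOfTails.lean (`sum_range_exp_mul_exp_neg_le`)
/-- `∑_{K<M} e^{λ(K+1)} e^{−K/(2Θ)} ≤ e^{λ}/(1 − e^{−(1/(2Θ) − λ)})` for `λ < 1/(2Θ)` (geometric series). -/
theorem pp_sum_range_exp_mul_exp_neg_le {lam Θ : ℝ} (hδ : 0 < 1 / (2 * Θ) - lam) (M : ℕ) :
    ∑ K ∈ Finset.range M, Real.exp (lam * ((K : ℝ) + 1)) * Real.exp (-((K : ℝ) / (2 * Θ))) ≤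
      Real.exp lam / (1 - Real.exp (-(1 / (2 * Θ) - lam))) := by
  set q : ℝ := Real.exp (-(1 / (2 * Θ) - lam)) with hq
  have hq0 : 0 ≤ q := (Real.exp_pos _).le
  have hq1 : q < 1 := Real.exp_lt_one_iff.2 (by linarith)
  have hterm : ∀ K : ℕ, Real.exp (lam * ((K : ℝ) + 1)) * Real.exp (-((K : ℝ) / (2 * Θ))) =
      Real.exp lam * q ^ K := by
    intro K
    rw [hq, ← Real.exp_nat_mul, ← Real.exp_add, ← Real.exp_add]
    congr 1
    ring
  have hsum : Summable fun K : ℕ => Real.exp lam * q ^ K := (summable_geometric_of_lt_one hq0 hq1).mul_left _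
  calc ∑ K ∈ Finset.range M, Real.exp (lam * ((K : ℝ) + 1)) * Real.exp (-((K : ℝ) / (2 * Θ)))
      = ∑ K ∈ Finset.range M, Real.exp lam * q ^ K := Finset.sum_congr rfl fun K _ => hterm K
    _ ≤ ∑' K : ℕ, Real.exp lam * q ^ K := hsum.sum_le_tsum (Finset.range M) (fun K _ => by positivity)
    _ = Real.exp lam / (1 - q) := by rw [tsum_mul_left, tsum_geometric_of_lt_one hq0 hq1, div_eq_mul_inv]

/-! ## The bound at one particle number -/

/-- **The bound at one (large) particle number.**  For nice profiles, `σ ≤ 1/2`, one flow `Φ` of `N + 1`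
spheres, a dialled `λ > 0` (`λ < 1/(2Θ)`, `λ < 1/(2Θ')`), a level cut `M`, a slack `δ ≥ 0` with
`tδ∑_{K<M}e^{λ(K+1)} ≤ 1/2`, the time-integrated bulk tail bound at `N` with slack `δ` and size `p` (all levels) and the
far-tail bound at `N` (all levels):
`P_N{t·C_λ + 1 < ∫₀ᵗ (N+1)⁻¹∑ᵢ e^{λ|vᵢ(s)|²} ds} ≤ 2(p∑_{K<M}e^{λ(K+1)} + tA'⁺e^{λ}ρ^M/(1 − ρ))`, `ρ = e^{−(1/(2Θ')−λ)}`
(`partOnePrime_markov_step` with `thr_K = 2A⁺e^{−K/(2Θ)} + δ`, `B = tA'⁺e^{λ}ρ^M`). -/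
theorem partOnePrime_bound_at {σ : ℝ} {a₀ θ₀ : T3 → ℝ} {u₀ : T3 → V3} (hP : NiceProfiles a₀ θ₀ u₀)
    (hσ2 : σ ≤ 1 / 2) {N : ℕ} (Φ : HardSphereFlow (Torus.geometry (Fin 3)) (hsDiameter σ N) (N + 1))
    {t lam Θ Θ' A A' δ p : ℝ} (ht : 0 < t) (hlam : 0 < lam)
    (hδ₁ : 0 < 1 / (2 * Θ) - lam) (hδ₂ : 0 < 1 / (2 * Θ') - lam) (M : ℕ) (hδ : 0 ≤ δ) (hp : 0 ≤ p)
    (hbulk : ∀ K : ℝ, ∫⁻ s in Icc 0 t, localGibbsLaw σ a₀ u₀ θ₀ N Φ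
      {z | 2 * A * Real.exp (-(K / (2 * Θ))) + δ < frac K (Φ.flow s z)} ≤ ENNReal.ofReal p)
    (hfar : ∀ K : ℝ,
      ∫⁻ z, (∫⁻ s in Icc 0 t, ENNReal.ofReal (frac K (Φ.flow s z))) ∂(localGibbsLaw σ a₀ u₀ θ₀ N Φ) ≤
        ENNReal.ofReal (t * A' * Real.exp (-(K / (2 * Θ')))))
    (hhalf : t * (δ * ∑ K ∈ Finset.range M, Real.exp (lam * ((K : ℝ) + 1))) ≤ 1 / 2) :
    localGibbsLaw σ a₀ u₀ θ₀ N Φ {z | t * (2 * max A 0 * (Real.exp lam / (1 - Real.exp (-(1 / (2 * Θ) - lam))))) + 1 <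
        ∫ s in Icc 0 t, ∫ y, Real.exp (lam * ‖y.2‖ ^ 2) ∂(empiricalMeasure (Φ.flow s z))} ≤
      ENNReal.ofReal (2 * (p * ∑ K ∈ Finset.range M, Real.exp (lam * ((K : ℝ) + 1)) +
        t * max A' 0 * Real.exp lam / (1 - Real.exp (-(1 / (2 * Θ') - lam))) *
          Real.exp (-(1 / (2 * Θ') - lam)) ^ M)) := by
  obtain ⟨ha₀, hθ, hu, ha0, hθ0⟩ := hP
  have hAp : A ≤ max A 0 := le_max_left _ _
  have hAp0 : 0 ≤ max A 0 := le_max_right _ _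
  have hAp' : A' ≤ max A' 0 := le_max_left _ _
  have hAp0' : 0 ≤ max A' 0 := le_max_right _ _
  set P : Measure (Cfg N) := localGibbsLaw σ a₀ u₀ θ₀ N Φ with hPdef
  have hprob : IsProbabilityMeasure P := isProbabilityMeasure_localGibbsLaw ha₀ hθ hu ha0 hθ0 hσ2 N Φ
  have hgood0 : P Φ.goodᶜ = 0 := by
    rw [hPdef, localGibbsLaw_eq]
    exact (localGibbsMeasure_absolutelyContinuous σ _ _ _ N Φ) Φ.measure_compl_good
  set S₁ : ℝ := ∑ K ∈ Finset.range M, Real.exp (lam * ((K : ℝ) + 1)) with hS₁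
  set δ' : ℝ := 1 / (2 * Θ') - lam with hδ'_def
  set ρ : ℝ := Real.exp (-δ') with hρ_def
  have hρ0 : 0 < ρ := Real.exp_pos _
  have hρ1 : ρ < 1 := Real.exp_lt_one_iff.2 (by linarith)
  set B : ℝ := t * max A' 0 * Real.exp lam * ρ ^ M with hB
  have hB0 : 0 ≤ B := by positivity
  set Cl : ℝ := 2 * max A 0 * (Real.exp lam / (1 - Real.exp (-(1 / (2 * Θ) - lam)))) with hCl
  have h1q : 0 < 1 - Real.exp (-(1 / (2 * Θ) - lam)) := sub_pos.2 (Real.exp_lt_one_iff.2 (by linarith))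
  have hCl0 : 0 ≤ Cl := by positivity
  set thr : ℕ → ℝ := fun K => 2 * max A 0 * Real.exp (-((K : ℝ) / (2 * Θ))) + δ with hthr
  have hthr0 : ∀ K, 0 ≤ thr K := fun K => by positivity
  -- (a) the deterministic bulk sum
  have hC : t * ∑ K ∈ Finset.range M, Real.exp (lam * ((K : ℝ) + 1)) * thr K ≤ t * Cl + 1 / 2 := by
    have hsplit : ∑ K ∈ Finset.range M, Real.exp (lam * ((K : ℝ) + 1)) * thr K =
        2 * max A 0 * ∑ K ∈ Finset.range M, Real.exp (lam * ((K : ℝ) + 1)) *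
          Real.exp (-((K : ℝ) / (2 * Θ))) + δ * S₁ := by
      rw [hS₁, Finset.mul_sum, Finset.mul_sum, ← Finset.sum_add_distrib]
      refine Finset.sum_congr rfl fun K _ => ?_
      simp only [hthr]
      ring
    have hgeo : 2 * max A 0 * ∑ K ∈ Finset.range M, Real.exp (lam * ((K : ℝ) + 1)) *
        Real.exp (-((K : ℝ) / (2 * Θ))) ≤ Cl := by
      rw [hCl]
      exact mul_le_mul_of_nonneg_left (pp_sum_range_exp_mul_exp_neg_le hδ₁ _) (by positivity)
    rw [hsplit, mul_add]
    exact add_le_add (mul_le_mul_of_nonneg_left hgeo ht.le) hhalf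
  -- (b) the time-integrated bulk bad events
  have hbulk' : ∀ K ∈ Finset.range M,
      ∫⁻ s in Icc 0 t, P {z | thr K < frac (K : ℝ) (Φ.flow s z)} ≤ ENNReal.ofReal p := by
    intro K _
    refine (lintegral_mono fun s => measure_mono fun z hz => ?_).trans (hbulk (K : ℝ))
    have he : 0 ≤ Real.exp (-((K : ℝ) / (2 * Θ))) := (Real.exp_pos _).le
    have hle : 2 * A * Real.exp (-((K : ℝ) / (2 * Θ))) + δ ≤ thr K := by
      show 2 * A * Real.exp (-((K : ℝ) / (2 * Θ))) + δ ≤ 2 * max A 0 * Real.exp (-((K : ℝ) / (2 * Θ))) + δ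
      exact add_le_add (mul_le_mul_of_nonneg_right (by linarith) he) le_rfl
    exact hle.trans_lt hz
  -- (c) the far levels
  have hfar' : ∀ j : ℕ, ENNReal.ofReal (Real.exp (lam * (((j + M : ℕ) : ℝ) + 1))) *
      ∫⁻ z, (∫⁻ s in Icc 0 t, ENNReal.ofReal (frac ((j + M : ℕ) : ℝ) (Φ.flow s z))) ∂P ≤
      ENNReal.ofReal (B * ρ ^ j) := by
    intro j
    have h := hfar (((j + M : ℕ) : ℝ))
    set x : ℝ := ((j + M : ℕ) : ℝ) with hx
    have hY : 0 ≤ t * Real.exp (-(x / (2 * Θ'))) := by positivity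
    have hmono : t * A' * Real.exp (-(x / (2 * Θ'))) ≤ t * max A' 0 * Real.exp (-(x / (2 * Θ'))) := by
      calc t * A' * Real.exp (-(x / (2 * Θ'))) = A' * (t * Real.exp (-(x / (2 * Θ')))) := by ring
        _ ≤ max A' 0 * (t * Real.exp (-(x / (2 * Θ')))) := mul_le_mul_of_nonneg_right hAp' hY
        _ = t * max A' 0 * Real.exp (-(x / (2 * Θ'))) := by ring
    have hxe : x = (j : ℝ) + (M : ℝ) := by rw [hx]; push_cast; ring
    have ex : Real.exp (lam * (x + 1)) * Real.exp (-(x / (2 * Θ'))) = Real.exp lam * ρ ^ M * ρ ^ j := by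
      rw [hρ_def, ← Real.exp_nat_mul, ← Real.exp_nat_mul, ← Real.exp_add, ← Real.exp_add, ← Real.exp_add, hxe,
        hδ'_def]
      congr 1
      ring
    have halg : Real.exp (lam * (x + 1)) * (t * max A' 0 * Real.exp (-(x / (2 * Θ')))) = B * ρ ^ j := by
      rw [hB]
      calc Real.exp (lam * (x + 1)) * (t * max A' 0 * Real.exp (-(x / (2 * Θ'))))
          = t * max A' 0 * (Real.exp (lam * (x + 1)) * Real.exp (-(x / (2 * Θ')))) := by ring
        _ = _ := by rw [ex]; ring
    calc ENNReal.ofReal (Real.exp (lam * (x + 1))) *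
          ∫⁻ z, (∫⁻ s in Icc 0 t, ENNReal.ofReal (frac x (Φ.flow s z))) ∂P
        ≤ ENNReal.ofReal (Real.exp (lam * (x + 1))) *
            ENNReal.ofReal (t * max A' 0 * Real.exp (-(x / (2 * Θ')))) :=
          mul_le_mul' le_rfl (h.trans (ENNReal.ofReal_le_ofReal hmono))
      _ = ENNReal.ofReal (B * ρ ^ j) := by rw [← ENNReal.ofReal_mul (Real.exp_pos _).le, halg]
  -- (d) the time-integrated Markov–Tonelli step
  have hstep : P {z | t * Cl + 1 < ∫ s in Icc 0 t, ((N + 1 : ℕ) : ℝ)⁻¹ *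
      ∑ i, Real.exp (lam * ‖(Φ.flow s z i).2‖ ^ 2)} ≤ ENNReal.ofReal (2 * (p * S₁ + B / (1 - ρ))) :=
    partOnePrime_markov_step Φ P hprob hgood0 lam t Cl p B ρ M thr hlam.le ht hCl0 hp hB0 hρ0.le hρ1 hthr0
      hC hbulk' hfar'
  have hsub : {z : Cfg N | t * Cl + 1 < ∫ s in Icc 0 t, ∫ y, Real.exp (lam * ‖y.2‖ ^ 2)
      ∂(empiricalMeasure (Φ.flow s z))} ⊆ {z | t * Cl + 1 < ∫ s in Icc 0 t, ((N + 1 : ℕ) : ℝ)⁻¹ *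
      ∑ i, Real.exp (lam * ‖(Φ.flow s z i).2‖ ^ 2)} := by
    intro z hz
    simp only [mem_setOf_eq, integral_empiricalMeasure] at hz ⊢
    exact hz
  have e : B / (1 - ρ) = t * max A' 0 * Real.exp lam / (1 - ρ) * ρ ^ M := by
    rw [hB]
    ring
  rw [e] at hstep
  exact (measure_mono hsub).trans hstep

/-! ## The stub -/

/-- STUB 6 `stub_partOnePrime` of the line `fibre-deficit-transfer`, skeleton r4 (PROVED): **for `0 < σ ≤ 1/2`,
nice profiles and `t > 0`, `IntegratedBulkTailAt ∧ FarTailAllAt ⇒ PartOneAt`** — the time-integrated sub-Maxwellian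
one-particle velocity tails at every level (rate-free output of the transfer) plus the far-tail occupation bound in
the mean at all levels imply component (i) of the crux verbatim, with the dialled `λ` of `pp_exists_dial` and the
fixed threshold `C := t·2A⁺e^{λ}/(1 − e^{−(1/(2Θ)−λ)}) + 1`; for every `η > 0` a fixed level cut `M`, a slack `δ` and a
size `ε` make `P_N(bad) ≤ η` eventually. -/
theorem stub_partOnePrime : ∀ (σ : ℝ) (a₀ θ₀ : T3 → ℝ) (u₀ : T3 → V3) (Φ : (N : ℕ) → HardSphereFlow (Torus.geometry (Fin 3)) (hsDiameter σ N) (N + 1)) (t : ℝ), 0 < σ → σ ≤ 1 / 2 → NiceProfiles a₀ θ₀ u₀ → 0 < t → IntegratedBulkTailAt σ a₀ θ₀ u₀ Φ t → FarTailAllAt σ a₀ θ₀ u₀ Φ t → PartOneAt σ a₀ θ₀ u₀ Φ t := by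
  intro σ a₀ θ₀ u₀ Φ t _hσ hσ2 hP ht hBulk hFar
  obtain ⟨Θ, A, hΘ, hbulk⟩ := hBulk
  obtain ⟨Θ', A', hΘ', N₀', hfar⟩ := hFar
  obtain ⟨lam, hlam, hδ₁, hδ₂⟩ := pp_exists_dial hΘ hΘ'
  set ρ : ℝ := Real.exp (-(1 / (2 * Θ') - lam)) with hρ_def
  have hρ0 : 0 < ρ := Real.exp_pos _
  have hρ1 : ρ < 1 := Real.exp_lt_one_iff.2 (by linarith)
  have h1ρ : 0 < 1 - ρ := sub_pos.2 hρ1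
  set Cl : ℝ := 2 * max A 0 * (Real.exp lam / (1 - Real.exp (-(1 / (2 * Θ) - lam)))) with hCl
  set c₂ : ℝ := t * max A' 0 * Real.exp lam / (1 - ρ) with hc₂
  have hAp0' : 0 ≤ max A' 0 := le_max_right _ _
  have hc₂0 : 0 ≤ c₂ := by positivity
  refine ⟨lam, t * Cl + 1, hlam, ?_⟩
  -- for every `η > 0`, eventually `P_N(bad) ≤ η`
  have hmain : ∀ η : ℝ, 0 < η → ∀ᶠ N in atTop, localGibbsLaw σ a₀ u₀ θ₀ N (Φ N)
      {z | t * Cl + 1 < ∫ s in Icc 0 t, ∫ y, Real.exp (lam * ‖y.2‖ ^ 2) ∂(empiricalMeasure ((Φ N).flow s z))} ≤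
      ENNReal.ofReal η := by
    intro η hη
    -- the fixed level cut `M`: the far part is `< η/4`
    have hT : Tendsto (fun M : ℕ => c₂ * ρ ^ M) atTop (𝓝 0) := by
      simpa using (tendsto_pow_atTop_nhds_zero_of_lt_one hρ0.le hρ1).const_mul c₂
    obtain ⟨M, hM⟩ := ((tendsto_order.1 hT).2 (η / 4) (by positivity)).exists
    set S₁ : ℝ := ∑ K ∈ Finset.range M, Real.exp (lam * ((K : ℝ) + 1)) with hS₁
    have hS₁0 : 0 ≤ S₁ := Finset.sum_nonneg fun K _ => (Real.exp_pos _).le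
    -- the slack `δ`: the deterministic slack part is `≤ 1/2`
    set δ : ℝ := 1 / (2 * t * S₁ + 2) with hδ_def
    have hδ0 : 0 < δ := by positivity
    have hhalf : t * (δ * S₁) ≤ 1 / 2 := by
      have e : t * (δ * S₁) = t * S₁ / (2 * t * S₁ + 2) := by rw [hδ_def]; ring
      rw [e, div_le_iff₀ (by positivity)]
      nlinarith [mul_nonneg ht.le hS₁0]
    -- the size `ε`: the bulk bad events cost `≤ η/4`
    set ε : ℝ := η / (4 * S₁ + 4) with hε_def
    have hε0 : 0 < ε := by positivity
    have hεS : ε * S₁ ≤ η / 4 := by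
      rw [hε_def, div_mul_eq_mul_div, div_le_div_iff₀ (by positivity) (by norm_num)]
      nlinarith [hη.le, hS₁0]
    obtain ⟨N₀, hN₀⟩ := hbulk δ hδ0 ε hε0
    filter_upwards [eventually_ge_atTop N₀, eventually_ge_atTop N₀'] with N hN hN'
    have h := partOnePrime_bound_at hP hσ2 (Φ N) ht hlam hδ₁ hδ₂ M hδ0.le hε0.le (hN₀ N hN) (hfar N hN') hhalf
    refine h.trans (ENNReal.ofReal_le_ofReal ?_)
    have h2 : c₂ * ρ ^ M < η / 4 := hM
    have h3 : t * max A' 0 * Real.exp lam / (1 - ρ) * ρ ^ M = c₂ * ρ ^ M := by rw [hc₂]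
    rw [h3]
    linarith
  -- conclusion
  refine ENNReal.tendsto_nhds_zero.2 fun e he => ?_
  rcases eq_or_ne e ⊤ with rfl | hne
  · exact Eventually.of_forall fun N => le_top
  · have hη : 0 < e.toReal := ENNReal.toReal_pos he.ne' hne
    filter_upwards [hmain e.toReal hη] with N hN
    rwa [ENNReal.ofReal_toReal hne] at hN

end Summit.AtomisticToContinuum.HydrodynamicLimit.Theorems.FibreDeficitTransfer

end
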